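import Summits.BirchSwinnertonDyer.Rank1Residual.Additive.KatoDescentKMCImpReadingPointwise
import HarnessLib

set_option autoImplicit false

/-!
# The two crux compositions (19945 `EllipticUnitValueSevenOfGZK`, 19223 `CccOneLawOnTypeIstarZero`) with the realisation
# reading taken ROW-KEYED — the `Kato2004.thm12_4`-free heads for the v6 Kato–Perrin-Riou skeletons
# (seat `bsd-cm-prr-ty1` g17, cell `bsd-cm`; theorems only: no definition, no named fact, no instance, no `sorry`; this file
# registers nothing — the planner touches the skeletons, D699)

Part 55 of the seat's kernel cut (cruxes stmt-BirchSwinnertonDyer-19945 / -19223; registered lines `kato_perrin_riou_zp` v5 /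
`kato_perrin_riou_istar` v5).  E50 (`KatoDescentKMCImpReadingPointwise.lean`, p721932) concludes each crux BY NAME from a ROW-KEYED count
reading (`hC7` / `hCrows`), the GENERIC realisation `hreal : TorsionFree.RealizableOfKMC IsOf KMC` (v4's stub 4 verbatim), the reading
binder, print inputs and the two research stubs.  v5 closes `hreal` in-file from `Kato2004.thm12_4 ∧ H2X′` (E49/E21); that use of Kato's
Thm. 12.4 is GENUINE off the rank-one rows (`rank_Λ 𝐇¹ ≤ 1` for every torsion-free member) but the compositions apply `hreal` ONLY at the
row pair, where GZK + `r_an = 1` are in scope and the realisation is a tree theorem modulo H2X′ (Part 54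
`StrictCount.realizable{ClassCSeven,IstarZero}OfGZK_of_loc`: (12.2.1), torsion-freeness, `z₀ ≠ 0` by Rohrlich, (R1)+(R2)).  THIS FILE
re-keys E50's heads to a ROW-KEYED realisation hypothesis whose binder text is E50's own row guard followed by stub 4's per-pair
conclusion — every OTHER binder type BYTE-IDENTICAL to E50's (planner D699: «nothing else moves»):
* §1 (interface binders, E50 §2 twins) `valueSevenOfGZK_of_rowCount_of_rowRealizable_of_perrinRiou (hC7) (hreal7) (hread) (hmod)
  (hCassels) (hKMC) (hPR)` with `hreal7 : ∀ W [..][..][Fact (Nat.Prime 7)], X12.ClassCSeven W → KMC W 7 → ∃ D, IsOf W 7 D`, and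
  `cccOneLawOnTypeIstarZero_of_rowCount_of_rowRealizable_of_perrinRiou (hCrows) (hrealRows) (hread) (hKMC) (hPR) (h₅) (h₆)` with
  `hrealRows : ∀ p [Fact p.Prime], 5 ≤ p → ∀ W [..][..], HasSignedLocalType W p (.Istar 0) → W.analyticRank = 1 → KMC W p → ∃ D, IsOf W p D`
  — same two-line proofs as E50 §2 (`rankOne_bsdp_of_countAt` per member; `RubinFormulaZpBsdp.ramifiedCMBottomClassIndexLawAtZp_of_bsdp` /
  `cccOneLawOnTypeIstarZero_of_bsdpOnType`);
* §2 (closed triple, GZK-guarded, E50 §3 `…_of_rowCountOfGZK_…` twins — THE v6 COMPOSITION HEADS)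
  ★ `valueSevenOfGZK_of_rowCountOfGZK_of_rowRealizableOfGZK_of_kmcFineContra_of_perrinRiouRatio (hC7) (hreal7) (hmod) (hCassels) (hKMC) (hPR)`
  with `hreal7 : rank_eq_analyticRank_of_analyticRank_le_one → ∀ (W) [W.IsElliptic] [W.IsGloballyMinimal] [Fact (Nat.Prime 7)],
  X12.ClassCSeven W → KatoMainConjectureFineContra W 7 → ∃ D, IsKatoZetaDescentDatumOfContra W 7 D` (= Part 54's
  `realizableClassCSevenOfGZK_of_loc hloc`), and ★ `cccOneLawOnTypeIstarZero_of_rowCountOfGZK_of_rowRealizableOfGZK_of_kmcFineContra_of_perrinRiouRatio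
  (hCrows) (hrealRows) (hKMC) (hPR) (h₅) (h₆)` with `hrealRows : rank_eq_analyticRank_of_analyticRank_le_one → ∀ p [Fact p.Prime], 5 ≤ p →
  ∀ W [..][..], HasSignedLocalType W p (.Istar 0) → W.analyticRank = 1 → KatoMainConjectureFineContra W p → ∃ D, IsKatoZetaDescentDatumOfContra W p D`
  (= Part 54's `realizableIstarZeroOfGZK_of_loc hloc`); GZK enters only through the existing guards (19945: the crux's antecedent;
  19223: `PublishedFactsInert.2.2.1`), the `→`-only reading discharged by `conj1210_of_isKatoZetaDescentDatumOfContra_of_katoMainConjectureFineContra`.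
v6 (planner's touch, D699): `stub_printFactsKato : H2X′ ∧ exists_isNewformOf`; `rowCount_closed := fun hGZK ↦ StrictCount.rankOneCountReading_…_of_loc_of_modularity
hGZK stub_printFactsKato.2 stub_printFactsKato.1` (Part 53); `realizable_closed := StrictCount.realizable…OfGZK_of_loc stub_printFactsKato.1` (Part 54);
composition `:= <§2 head> rowCount_closed realizable_closed …`.
HONEST LABEL: every statement is CONDITIONAL on displayed hypotheses (the row count reading, the row realisation, GZK, modularity,
Cassels / the K8 support items, KMC and PR^× on the rows); the cruxes are concluded BY NAME, never restated; 19945 / 19223 stay OPEN;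
no stub is closed on the ledger; no summit statement is proved by this seat; BSD is not proved for any curve.
[cite: BurnsKuriharaSano2019, Thm. 7.3 and Thm. 7.6 (p. 29), Conj. 2.8 (p. 10)]
[cite: Kato2004Asterisque, Thm. 12.4 (2) (p. 221), Conj. 12.10 (p. 224), §14.14 and Lemma 14.15 (pp. 243–244), Prop. 14.16 (p. 244)]
[cite: Miller2011LMS, §1 and Def. 1.1] [cite: Cassels1965ArithmeticVIII] [cite: Kobayashi2003, §4 (p. 8), Thm. 7.4 (p. 13)]
-/

noncomputable section

open scoped Classical NumberField

open WeierstrassCurve Literature.NumberTheory.EllipticCurves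
  Literature.NumberTheory.EllipticCurves.Rank1Residual
  Literature.NumberTheory.EllipticCurves.Rank1Residual.Typed
  Literature.NumberTheory.EllipticCurves.IwasawaAlgebra
open Summit.BirchSwinnertonDyer.Rank1Residual
open Summit.BirchSwinnertonDyer.Rank1Residual.Additive
open Summit.BirchSwinnertonDyer.Rank1Residual.X12.O10
open Summit.BirchSwinnertonDyer.Rank1Residual.X12.O11
open Summit.BirchSwinnertonDyer.BirchSwinnertonDyer.Theses.RamifiedSevenEllipticUnits
open Summit.BirchSwinnertonDyer.BirchSwinnertonDyer.Theses.InertBadSignedBranches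
open Summit.BirchSwinnertonDyer.BirchSwinnertonDyer.Theorems
open Summit.BirchSwinnertonDyer.BirchSwinnertonDyer.Theorems.CccOneLowerHalf
open Summit.BirchSwinnertonDyer.BirchSwinnertonDyer.Theorems.RamifiedSevenEllipticUnits

namespace Summit.BirchSwinnertonDyer.Rank1Residual.Additive.KMCImpReadingPointwise

/-! ## §1 The two cruxes BY NAME from a row-keyed count AND a row-keyed realisation, over the interface binders -/

section RowKeyed

variable {IsOf : ∀ (W : WeierstrassCurve ℚ) [W.IsElliptic] [W.IsGloballyMinimal] (p : ℕ) [Fact p.Prime],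
  KatoDescentDatum p → Prop}
variable {PRRatio : ∀ (W : WeierstrassCurve ℚ) [W.IsElliptic] [W.IsGloballyMinimal] (p : ℕ)
  [Fact p.Prime], ℚ_[p] → Prop}
variable {KMC : ∀ (W : WeierstrassCurve ℚ) [W.IsElliptic] [W.IsGloballyMinimal] (p : ℕ), Prop}

/-- **Crux 19945 `EllipticUnitValueSevenOfGZK` ⟸ KMC(T₇W) ∧ PR^×(W, 7) on 𝒞₇, count AND realisation keyed TO THE ROWS** — E50
`valueSevenOfGZK_of_rowCount_of_perrinRiou` with `hreal : TorsionFree.RealizableOfKMC IsOf KMC` replaced by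
`hreal7 : ∀ W ∈ 𝒞₇, KMC W 7 → ∃ D, IsOf W 7 D` (the only instance E50 consumes); every other binder type identical.  Per member: E50 §1
`rankOne_bsdp_of_countAt` + `RubinFormulaZpBsdp.ramifiedCMBottomClassIndexLawAtZp_of_bsdp`.  The crux is concluded BY NAME.  CONDITIONAL;
19945 stays OPEN. [cite: BurnsKuriharaSano2019, Thm. 7.6 (p. 29)] [cite: Kato2004Asterisque, Conj. 12.10 (p. 224), §15] [cite: Cassels1965ArithmeticVIII] -/
theorem valueSevenOfGZK_of_rowCount_of_rowRealizable_of_perrinRiou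
    (hC7 : ∀ (W : WeierstrassCurve ℚ) [W.IsElliptic] [W.IsGloballyMinimal] [Fact (Nat.Prime 7)],
      X12.ClassCSeven W →
      ∀ (D : KatoDescentDatum 7) (ℒ : ℚ_[7]), IsOf W 7 D → PRRatio W 7 ℒ →
        Finite (coinvariants 7 D.H2) ∧ (ℒ ≠ 0 ↔ D.zetaIndex ≠ 0) ∧
          ∀ m : ℕ, D.zetaIndex = 7 ^ m * D.h2Card →
            ℒ.valuation = (m : ℤ) +
              padicValNat 7 (Nat.card (AddCommGroup.primaryComponent W.sha 7)) +
              padicValNat 7 W.tamagawaProduct)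
    (hreal7 : ∀ (W : WeierstrassCurve ℚ) [W.IsElliptic] [W.IsGloballyMinimal] [Fact (Nat.Prime 7)],
      X12.ClassCSeven W → KMC W 7 → ∃ D : KatoDescentDatum 7, IsOf W 7 D)
    (hread : ∀ (W : WeierstrassCurve ℚ) [W.IsElliptic] [W.IsGloballyMinimal] (p : ℕ) [Fact p.Prime]
      (D : KatoDescentDatum p), IsOf W p D → KMC W p → D.Conj1210)
    (hmod : hasEntireLFunction_rat) (hCassels : bsdRHS_eq_of_isIsogenous)
    (hKMC : ∀ (W : WeierstrassCurve ℚ) [W.IsElliptic] [W.IsGloballyMinimal] [Fact (Nat.Prime 7)],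
      X12.ClassCSeven W → KMC W 7)
    (hPR : ∀ (W : WeierstrassCurve ℚ) [W.IsElliptic] [W.IsGloballyMinimal] [Fact (Nat.Prime 7)],
      X12.ClassCSeven W → PerrinRiouUpToUnitAt PRRatio W 7) :
    EllipticUnitValueSevenOfGZK :=
  fun hGZK W _ _ _ h7 ↦
    RubinFormulaZpBsdp.ramifiedCMBottomClassIndexLawAtZp_of_bsdp hCassels hmod hGZK
      (le_of_eq h7.2.2.1)
      (rankOne_bsdp_of_countAt W 7 (hC7 W h7) (fun hK ↦ hreal7 W h7 hK)
        hread hGZK hmod h7.2.2.1 (ValueOfKMCPerrinRiou.not_seven_dvd_torsionOrder W h7)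
        (hPR W h7) (hKMC W h7))

/-- **Crux 19223 `CccOneLawOnTypeIstarZero` ⟸ KMC(T_pW) ∧ PR^×(W, p) at every rank-one pair of the type `(p, I₀*)`, `p ≥ 5`, count AND
realisation keyed TO THE ROWS** — E50 `cccOneLawOnTypeIstarZero_of_rowCount_of_perrinRiou` with `hreal` replaced by
`hrealRows : ∀ p ≥ 5, ∀ W of type (p, I₀*) with r_an = 1, KMC W p → ∃ D, IsOf W p D`; every other binder type identical.  Per pair: E50 §1
`rankOne_bsdp_of_countAt`, then `cccOneLawOnTypeIstarZero_of_bsdpOnType`.  The crux is concluded BY NAME.  CONDITIONAL; 19223 stays OPEN.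
[cite: BurnsKuriharaSano2019, Thm. 7.6 (p. 29)] [cite: Kato2004Asterisque, Conj. 12.10 (p. 224), §15] [cite: Kobayashi2003, §4 (p. 8), Thm. 7.4 (p. 13)] -/
theorem cccOneLawOnTypeIstarZero_of_rowCount_of_rowRealizable_of_perrinRiou
    (hCrows : ∀ (p : ℕ) [Fact p.Prime], 5 ≤ p → ∀ (W : WeierstrassCurve ℚ) [W.IsElliptic] [W.IsGloballyMinimal],
      HasSignedLocalType W p (.Istar 0) → W.analyticRank = 1 →
      ∀ (D : KatoDescentDatum p) (ℒ : ℚ_[p]), IsOf W p D → PRRatio W p ℒ →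
        Finite (coinvariants p D.H2) ∧ (ℒ ≠ 0 ↔ D.zetaIndex ≠ 0) ∧
          ∀ m : ℕ, D.zetaIndex = p ^ m * D.h2Card →
            ℒ.valuation = (m : ℤ) +
              padicValNat p (Nat.card (AddCommGroup.primaryComponent W.sha p)) +
              padicValNat p W.tamagawaProduct)
    (hrealRows : ∀ (p : ℕ) [Fact p.Prime], 5 ≤ p → ∀ (W : WeierstrassCurve ℚ) [W.IsElliptic] [W.IsGloballyMinimal],
      HasSignedLocalType W p (.Istar 0) → W.analyticRank = 1 → KMC W p → ∃ D : KatoDescentDatum p, IsOf W p D)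
    (hread : ∀ (W : WeierstrassCurve ℚ) [W.IsElliptic] [W.IsGloballyMinimal] (p : ℕ) [Fact p.Prime]
      (D : KatoDescentDatum p), IsOf W p D → KMC W p → D.Conj1210)
    (hKMC : ∀ (p : ℕ) [Fact p.Prime], 5 ≤ p → ∀ (W : WeierstrassCurve ℚ) [W.IsElliptic]
      [W.IsGloballyMinimal], HasSignedLocalType W p (.Istar 0) → W.analyticRank = 1 → KMC W p)
    (hPR : ∀ (p : ℕ) [Fact p.Prime], 5 ≤ p → ∀ (W : WeierstrassCurve ℚ) [W.IsElliptic]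
      [W.IsGloballyMinimal], HasSignedLocalType W p (.Istar 0) → W.analyticRank = 1 →
      PerrinRiouUpToUnitAt PRRatio W p)
    (h₅ : PrintReadingsInert) (h₆ : PublishedFactsInert) : CccOneLawOnTypeIstarZero := by
  obtain ⟨hmod, -, hGZK, hPT, -, -⟩ := h₆
  refine cccOneLawOnTypeIstarZero_of_bsdpOnType h₅ hmod hGZK hPT fun p _ hp5 W _ _ hT hr ↦ ?_
  obtain ⟨-, -, htors⟩ :=
    CccOneKMCPerrinRiou.addv_and_j_nonneg_and_not_dvd_torsionOrder_of_hasSignedLocalType W p (by omega) hT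
  exact rankOne_bsdp_of_countAt W p (hCrows p hp5 W hT hr) (fun hK ↦ hrealRows p hp5 W hT hr hK) hread hGZK hmod hr htors
    (hPR p hp5 W hT hr) (hKMC p hp5 W hT hr)

end RowKeyed

/-! ## §2 At the PRINT-EXACT closed triple, GZK-guarded: the v6 composition heads -/

section Closed

/-- ★ **Crux 19945 BY NAME from a ROW-KEYED stub 3 and a ROW-KEYED stub 4, both GUARDED BY GZK** — E50
`valueSevenOfGZK_of_rowCountOfGZK_of_kmcFineContra_of_perrinRiouRatio` with `hreal` replaced by the row-keyed, GZK-guarded realisation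
`hreal7` (the shape of Part 54 `StrictCount.realizableClassCSevenOfGZK_of_loc hloc`); `hC7`, `hmod`, `hCassels`, `hKMC`, `hPR` BYTE-IDENTICAL to
E50's; the `→`-only reading discharged by `conj1210_of_isKatoZetaDescentDatumOfContra_of_katoMainConjectureFineContra` (p628155); GZK is the crux's
own antecedent.  Intended as the composition term of the planner's zp v6 (this file registers nothing).  CONDITIONAL; 19945 stays OPEN;
BSD is not proved. [cite: BurnsKuriharaSano2019, Thm. 7.6 (p. 29), Conj. 2.8 (ii) (p. 10)] [cite: Kato2004Asterisque, Conj. 12.10 (p. 224), §14.14 (p. 243)]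
[cite: Cassels1965ArithmeticVIII] -/
theorem valueSevenOfGZK_of_rowCountOfGZK_of_rowRealizableOfGZK_of_kmcFineContra_of_perrinRiouRatio
    (hC7 : rank_eq_analyticRank_of_analyticRank_le_one →
      ∀ (W : WeierstrassCurve ℚ) [W.IsElliptic] [W.IsGloballyMinimal] [Fact (Nat.Prime 7)],
      X12.ClassCSeven W →
      ∀ (D : KatoDescentDatum 7) (ℒ : ℚ_[7]),
        IsKatoZetaDescentDatumOfContra W 7 D → Kato2004.PRRatio W 7 ℒ →
        Finite (coinvariants 7 D.H2) ∧ (ℒ ≠ 0 ↔ D.zetaIndex ≠ 0) ∧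
          ∀ m : ℕ, D.zetaIndex = 7 ^ m * D.h2Card →
            ℒ.valuation = (m : ℤ) +
              padicValNat 7 (Nat.card (AddCommGroup.primaryComponent W.sha 7)) +
              padicValNat 7 W.tamagawaProduct)
    (hreal7 : rank_eq_analyticRank_of_analyticRank_le_one →
      ∀ (W : WeierstrassCurve ℚ) [W.IsElliptic] [W.IsGloballyMinimal] [Fact (Nat.Prime 7)],
      X12.ClassCSeven W →
      KatoMainConjectureFineContra W 7 → ∃ D : KatoDescentDatum 7, IsKatoZetaDescentDatumOfContra W 7 D)
    (hmod : hasEntireLFunction_rat) (hCassels : bsdRHS_eq_of_isIsogenous)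
    (hKMC : ∀ (W : WeierstrassCurve ℚ) [W.IsElliptic] [W.IsGloballyMinimal] [Fact (Nat.Prime 7)],
      X12.ClassCSeven W → KatoMainConjectureFineContra W 7)
    (hPR : ∀ (W : WeierstrassCurve ℚ) [W.IsElliptic] [W.IsGloballyMinimal] [Fact (Nat.Prime 7)],
      X12.ClassCSeven W → PerrinRiouUpToUnitAt Kato2004.PRRatio W 7) :
    EllipticUnitValueSevenOfGZK :=
  fun hGZK ↦ valueSevenOfGZK_of_rowCount_of_rowRealizable_of_perrinRiou (hC7 hGZK) (hreal7 hGZK)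
    (fun _ _ _ _ _ _ hD hK ↦ conj1210_of_isKatoZetaDescentDatumOfContra_of_katoMainConjectureFineContra hD hK)
    hmod hCassels hKMC hPR hGZK

/-- ★ **Crux 19223 BY NAME from a ROW-KEYED stub 3 and a ROW-KEYED stub 4, both GUARDED BY GZK** — E50
`cccOneLawOnTypeIstarZero_of_rowCountOfGZK_of_kmcFineContra_of_perrinRiouRatio` with `hreal` replaced by the row-keyed, GZK-guarded
realisation `hrealRows` (the shape of Part 54 `StrictCount.realizableIstarZeroOfGZK_of_loc hloc`); `hCrows`, `hKMC`, `hPR`, `h₅`, `h₆`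
BYTE-IDENTICAL to E50's; GZK = the conjunct `PublishedFactsInert.2.2.1` of the route's support item.  Intended as the composition term of the
planner's istar v6 (this file registers nothing).  CONDITIONAL; 19223 stays OPEN; BSD is not proved.
[cite: BurnsKuriharaSano2019, Thm. 7.6 (p. 29), Conj. 2.8 (ii) (p. 10)] [cite: Kobayashi2003, §4 (p. 8), Thm. 7.4 (p. 13)] -/
theorem cccOneLawOnTypeIstarZero_of_rowCountOfGZK_of_rowRealizableOfGZK_of_kmcFineContra_of_perrinRiouRatio
    (hCrows : rank_eq_analyticRank_of_analyticRank_le_one →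
      ∀ (p : ℕ) [Fact p.Prime], 5 ≤ p → ∀ (W : WeierstrassCurve ℚ) [W.IsElliptic] [W.IsGloballyMinimal],
      HasSignedLocalType W p (.Istar 0) → W.analyticRank = 1 →
      ∀ (D : KatoDescentDatum p) (ℒ : ℚ_[p]),
        IsKatoZetaDescentDatumOfContra W p D → Kato2004.PRRatio W p ℒ →
        Finite (coinvariants p D.H2) ∧ (ℒ ≠ 0 ↔ D.zetaIndex ≠ 0) ∧
          ∀ m : ℕ, D.zetaIndex = p ^ m * D.h2Card →
            ℒ.valuation = (m : ℤ) +
              padicValNat p (Nat.card (AddCommGroup.primaryComponent W.sha p)) +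
              padicValNat p W.tamagawaProduct)
    (hrealRows : rank_eq_analyticRank_of_analyticRank_le_one →
      ∀ (p : ℕ) [Fact p.Prime], 5 ≤ p → ∀ (W : WeierstrassCurve ℚ) [W.IsElliptic] [W.IsGloballyMinimal],
      HasSignedLocalType W p (.Istar 0) → W.analyticRank = 1 →
      KatoMainConjectureFineContra W p → ∃ D : KatoDescentDatum p, IsKatoZetaDescentDatumOfContra W p D)
    (hKMC : ∀ (p : ℕ) [Fact p.Prime], 5 ≤ p → ∀ (W : WeierstrassCurve ℚ) [W.IsElliptic]
      [W.IsGloballyMinimal], HasSignedLocalType W p (.Istar 0) → W.analyticRank = 1 →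
      KatoMainConjectureFineContra W p)
    (hPR : ∀ (p : ℕ) [Fact p.Prime], 5 ≤ p → ∀ (W : WeierstrassCurve ℚ) [W.IsElliptic]
      [W.IsGloballyMinimal], HasSignedLocalType W p (.Istar 0) → W.analyticRank = 1 →
      PerrinRiouUpToUnitAt Kato2004.PRRatio W p)
    (h₅ : PrintReadingsInert) (h₆ : PublishedFactsInert) : CccOneLawOnTypeIstarZero :=
  cccOneLawOnTypeIstarZero_of_rowCount_of_rowRealizable_of_perrinRiou (hCrows h₆.2.2.1) (hrealRows h₆.2.2.1)
    (fun _ _ _ _ _ _ hD hK ↦ conj1210_of_isKatoZetaDescentDatumOfContra_of_katoMainConjectureFineContra hD hK)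
    hKMC hPR h₅ h₆

end Closed

end Summit.BirchSwinnertonDyer.Rank1Residual.Additive.KMCImpReadingPointwise

end
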